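import Summits.QuantumFields.YangMills.Theorems.FluctuationComparisonRegPrIntLS2BetaGapOrbitOfStrataTwo
import HarnessLib

/-!
# S2β · GAP♯∘ WITH A CO-HEIGHT FLOOR FROM ITS TWO FLOORED STRATA LETTERS: ✓`uniformFibreGapOrbit_of_strata` (px16 g20, `hFlat` discharged by ✓`hFlat_holds`) with
# the irreducible ∕ case-A′ letters asked, and `UniformFibreGapOrbit`'s body concluded, only at heights `J ≥ J₀` — the assembly the floored WLOG door feeds

Cell `ym3-torus` (YM ladder rung R3 = continuum `SU(2)` Yang–Mills on the three-torus at fixed lattice data — a RUNG: NOT d = 4, NOT infinite volume, NOT a mass gap,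
NOT Clay).  Width seat «width 5» `ym3-torus-px5` (gen 24), FREE px helper on crux `stmt-QuantumFields-20520`; `--kind proof --supports stmt-QuantumFields-20520 --as
helper`, count-neutral, DEFINITION-FREE (0 `def`, 0 `instance`, 0 `notation`, 0 `sorry`; default heartbeats).

WHY (LEAD w3 g29 №30 «DECIDING NOTE», 2026-08-31 23:32:22Z; RULING №65; planner petition (P5) — ADOPTED, desk RULING №120 23:43:47Z: registry edition v12
«S2β ∕ GAP♯∘ SEED HEIGHT FLOOR», `def UniformFibreGapOrbit` re-lettered `… γ ≤ γ₁ → ∃ J₀ : ℕ, ∀ (J K : ℕ) (hJ₀ : J₀ ≤ J) (hJK : J ≤ K) (V : …), …`, LEAD SIGNATURE e8f172bb989b0233).  Both small-bond bridge letters of the guarded-strata road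
(`hsupp(G_IRR, G_IRR ∧ G_{s₀})`, `hsupp(G_A′, G_A′ ∧ G_{s₀})`) are FALSE BY KERNEL as `∀ F ∀ J` letters (px8 g24 ✓`not_hsupp_irrStratum`, ✓`not_hsupp_abelianStratum`:
near-flat tori at `(F.m, J) = (1, 0)` defeat every small-bond gauge), so «no WLOG-small-bond-gauge architecture can conclude the REGISTERED (floor-free) GAP♯∘ text»; the
road is load-bearing exactly for a HEIGHT-FLOORED edition `… ∀ F γ, … ∃ J₀, ∀ J K, J₀ ≤ J → J ≤ K → …` — the letter the LINE already consumes (ideator g33 v19.2 «SEED HEIGHT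
FLOOR», `J₀` after `∀ F γ`).  The floored WLOG door ✓∕⧗`…StratumBodyGaugeWLOGFloor.gapStratum_of_goodGauge_floor` (this seat) turns a floored supplier `hsupp^{≥J₀}` and the
guarded-stratum body into the FLOORED stratum letter at `G_IRR` ∕ `G_A′`; THIS FILE is the matching assembly: the two floored strata letters ⟹ the floored GAP♯∘ body.  px16's
✓ proof is pointwise in `(F, γ, J, K, V)` — three strata by ✓`irr_or_caseA_or_loopHol_central V`, the flat ∕ case-B one by ✓`hFlat_holds` + ✓`gapFlatAt_caseB_of_flat_atArgmin` +
✓`gapAt_depthZero` (no floor needed there) — so the floor threads through as `J₀ := max J₀ᴵᴿᴿ J₀ᴬ` per `(F, γ)`.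

WHAT IS PROVED (sorry-free).  ★★★ `uniformFibreGapOrbit_of_strata_floor (hIrr) (hA)` — ✓`uniformFibreGapOrbit_of_strata` with EXACTLY these edits in `hIrr`, `hA` AND the
conclusion: `∃ J₀ : ℕ,` inserted after `γ ≤ γ₁ →`, and the binder `(hJ₀ : J₀ ≤ J)` inserted right after `∀ (J K : ℕ)` (before `(hJK : J ≤ K)`, v19.2's order) — every other
token VERBATIM (the conclusion is `UniformFibreGapOrbit`'s v11.4 body, `argminHist`∕`ResidualGauge` unfolded, AT HEIGHTS `J ≥ J₀`).  `hIrr^{≥J₀}`∕`hA^{≥J₀}` = the floored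
door's conclusion at `G := G_IRR` ∕ `G := G_A′` (texts of ✓p836047 knit v7 ∕ w5 g28 (B) VERBATIM), so «(B)-floor» is ONE TERM: `uniformFibreGapOrbit_of_strata_floor
(gapStratum_of_goodGauge_floor G_IRR G₁′ hsupp₁ body₁) (gapStratum_of_goodGauge_floor G_A′ G₂′ hsupp₂ body₂)`.

DOMAIN SENTENCE (RULING №115 R5).  Pure assembly; holds for every pair of floored strata letters.  The conclusion is GAP♯∘ AT HEIGHTS `J ≥ J₀(F, γ, …)` = the v12 text of
`UniformFibreGapOrbit` with `argminHist` ∕ `ResidualGauge` unfolded (the registry file itself is the planner's ∕ LEAD-as-delegate's write, not this helper's; under v11's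
floor-free text this theorem is its `J ≥ J₀` restriction).  So on v12 the registered stub has the two-letter door `stub_uniformFibreGapOrbit ⟸ uniformFibreGapOrbit_of_strata_floor
hIrr^{≥J₀} hA^{≥J₀}` by ONE TERM, as v11 had px16's ✓`uniformFibreGapOrbit_of_strata`.

HONEST SCOPE.  Quantifier plumbing over landed theorems (px16 g18–g20 lineage ✓`uniformFibreGapOrbit_of_strata_of_flat`, px17 g19 ✓`hFlat_holds`); nothing of Bałaban's
analysis asserted or proved ([Balaban1985Variational] Thm 1 p.279, (142) p.299 = what the strata letters transcribe); `hIrr^{≥J₀}`, `hA^{≥J₀}`, `hsupp`-above-the-floor ((BG∞)),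
hD ×2, hDBX ×2, h3 HYPOTHESES∕OPEN; GAP♯∘ (`stub_uniformFibreGapOrbit`), the five registered stubs (0∕5), S2β, 20520, 19936, 19200, `YM3TorusSU2` NOT proved; no registered
stub closed; rung R3 — NOT d = 4, NOT infinite volume, NOT a mass gap, NOT Clay; the Yang–Mills mass gap is NOT proved.
-/

set_option autoImplicit false

noncomputable section

open Set Function
open scoped Matrix.Norms.L2Operator
open Literature.MathematicalPhysics.QuantumFieldTheory.Balaban1983to89
open Literature.MathematicalPhysics.QuantumFieldTheory.Balaban1983to89.T4Continuum
open Literature.MathematicalPhysics.QuantumFieldTheory.Balaban1983to89.B10Eq27TorusAxialLog (unitsField toUField)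
open Literature.MathematicalPhysics.QuantumFieldTheory.Balaban1983to89.B9AdOrthogonal (σ₃)
open Literature.MathematicalPhysics.QuantumFieldTheory.Balaban1983to89.T3ContinuumYM3Torus
open Literature.MathematicalPhysics.QuantumFieldTheory.Balaban1983to89.T3UnitLawDensityEML (ℰp)
open Literature.MathematicalPhysics.QuantumFieldTheory.Balaban1983to89.T3UnitScaleTilt
open Literature.MathematicalPhysics.QuantumFieldTheory.Balaban1983to89.T3TiltDescent
open Literature.MathematicalPhysics.QuantumFieldTheory.Balaban1983to89.T3Thresholds (exists_gamma_forall_θBal_le)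
open Literature.MathematicalPhysics.QuantumFieldTheory.Balaban1983to89.T3ConstrainedMinimiser (fibre)
open Literature.MathematicalPhysics.QuantumFieldTheory.Balaban1983to89.T3PrintedRegularMinimiser
open Literature.MathematicalPhysics.QuantumFieldTheory.Balaban1983to89.T3PrintedRegularOrbits
open scoped Literature.MathematicalPhysics.QuantumFieldTheory.Balaban1983to89.T3OrbitAverage
open Summit.QuantumFields.YangMills.Theorems.FluctuationComparisonRegPrIntLS2BetaWindowStrataCaseB (irr_or_caseA_or_loopHol_central)
open Summit.QuantumFields.YangMills.Theorems.FluctuationComparisonRegPrIntLS2BetaGapOrbitOfStrata (gapBody_mono_mu gapAt_depthZero gapFlatAt_caseB_of_flat_atArgmin)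
open Summit.QuantumFields.YangMills.Theorems.FluctuationComparisonRegPrIntLS2BetaHFlat (hFlat_holds)

namespace Summit.QuantumFields.YangMills.Theorems.FluctuationComparisonRegPrIntLS2BetaGapOrbitOfStrataFloor

/-- ★★★ **THE FLOORED GAP♯∘ BODY FROM ITS TWO FLOORED STRATA LETTERS** (✓`uniformFibreGapOrbit_of_strata` with a co-height floor `J₀` after `∀ F γ` in `hIrr`, `hA` and the
conclusion; `hFlat` discharged by ✓`hFlat_holds`): irreducible data by `hIrr` above `J₀ᴵᴿᴿ`, case-A′ data by `hA` above `J₀ᴬ`, case B ∕ depth zero at every height by the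
flat transport — hence everything above `max J₀ᴵᴿᴿ J₀ᴬ`, with `μ := min μ_IRR (min μ_A μ_flat)` as in the ✓ proof.
[cite: Balaban1985Variational, Thm 1 p.279 and (142) p.299; Balaban1984PropagatorsI, Prop. 1.1 (1.89)-(1.90) p.33] -/
theorem uniformFibreGapOrbit_of_strata_floor
    (hIrr : ∀ (L : ℕ), ∃ c₀ : ℝ, 0 < c₀ ∧ c₀ ≤ 1 ∧ ∀ (cw : ℝ), 0 < cw → cw ≤ c₀ → ∃ pS : ℝ, ∀ (b₀ p₀ : ℝ), 0 < b₀ → pS ≤ p₀ → 0 < p₀ → ∃ ε₁ : ℝ, 0 < ε₁ ∧ ∀ (ε₀ : ℝ), 0 < ε₀ → ε₀ ≤ ε₁ →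
    ∃ γ₁ : ℝ, 0 < γ₁ ∧ ∃ μ : ℝ, 0 < μ ∧ ∀ (F : T3Family) (γ : ℝ), F.L = L → 0 < γ → γ ≤ γ₁ → ∃ J₀ : ℕ,
      ∀ (J K : ℕ) (hJ₀ : J₀ ≤ J) (hJK : J ≤ K) (V : GaugeField (F.P J) 0 (Matrix.specialUnitaryGroup (Fin 2) ℂ)), PlaqSmall (θBal F.L γ (cw * b₀) p₀ J) V →
        (∀ c : Site (F.P J) 0 → Matrix (Fin 2) (Fin 2) ℂ,
          (∀ e : PBond (F.P J) 0, c e.src = ((unitsField (toUField V) e : (Matrix (Fin 2) (Fin 2) ℂ)ˣ) : Matrix (Fin 2) (Fin 2) ℂ) * c e.tgt *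
            (((unitsField (toUField V) e)⁻¹ : (Matrix (Fin 2) (Fin 2) ℂ)ˣ) : Matrix (Fin 2) (Fin 2) ℂ)) →
          ∃ z : ℂ, ∀ y, c y = z • (1 : Matrix (Fin 2) (Fin 2) ℂ)) →
        ∀ U₀ ∈ {U' : GaugeField (F.P K) 0 (Matrix.specialUnitaryGroup (Fin 2) ℂ) | U' ∈ fibre F ℰp J K hJK V ∧ U' ∈ histGood F ℰp (θBal F.L γ b₀ p₀) K J ∧
            wilsonAction4 U' = minActionRegPr F J K hJK ε₀ V},
        ∀ U ∈ fibre F ℰp J K hJK V, U ∈ histGood F ℰp (θBal F.L γ b₀ p₀) K J →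
          μ * ((F.L : ℝ)⁻¹) ^ (2 * (K - J)) *
              (⨅ w : {w : GaugeTransf (F.P K) 0 (Matrix.specialUnitaryGroup (Fin 2) ℂ) | ∀ U : GaugeField (F.P K) 0 (Matrix.specialUnitaryGroup (Fin 2) ℂ),
                  descendTo F ℰp J K hJK (GaugeField.gaugeAct w U) = descendTo F ℰp J K hJK U}, ∑ ℓ : PBond (F.P K) 0,
                dist1 (U ℓ * ((GaugeField.gaugeAct (w : GaugeTransf (F.P K) 0 (Matrix.specialUnitaryGroup (Fin 2) ℂ)) U₀) ℓ)⁻¹) ^ 2)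
            ≤ wilsonAction4 U - minActionRegPr F J K hJK ε₀ V)
    (hA : ∀ (L : ℕ), ∃ c₀ : ℝ, 0 < c₀ ∧ c₀ ≤ 1 ∧ ∀ (cw : ℝ), 0 < cw → cw ≤ c₀ → ∃ pS : ℝ, ∀ (b₀ p₀ : ℝ), 0 < b₀ → pS ≤ p₀ → 0 < p₀ → ∃ ε₁ : ℝ, 0 < ε₁ ∧ ∀ (ε₀ : ℝ), 0 < ε₀ → ε₀ ≤ ε₁ →
    ∃ γ₁ : ℝ, 0 < γ₁ ∧ ∃ μ : ℝ, 0 < μ ∧ ∀ (F : T3Family) (γ : ℝ), F.L = L → 0 < γ → γ ≤ γ₁ → ∃ J₀ : ℕ,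
      ∀ (J K : ℕ) (hJ₀ : J₀ ≤ J) (hJK : J ≤ K) (V : GaugeField (F.P J) 0 (Matrix.specialUnitaryGroup (Fin 2) ℂ)), PlaqSmall (θBal F.L γ (cw * b₀) p₀ J) V →
        (∃ g : GaugeTransf (F.P J) 0 (Matrix.specialUnitaryGroup (Fin 2) ℂ),
          (∀ e : PBond (F.P J) 0, Commute (((GaugeField.gaugeAct g V) e : Matrix.specialUnitaryGroup (Fin 2) ℂ) : Matrix (Fin 2) (Fin 2) ℂ) σ₃) ∧
          ∀ c : Site (F.P J) 0 → Matrix (Fin 2) (Fin 2) ℂ,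
            (∀ e : PBond (F.P J) 0, c e.src = ((unitsField (toUField (GaugeField.gaugeAct g V)) e : (Matrix (Fin 2) (Fin 2) ℂ)ˣ) : Matrix (Fin 2) (Fin 2) ℂ) * c e.tgt *
            (((unitsField (toUField (GaugeField.gaugeAct g V)) e)⁻¹ : (Matrix (Fin 2) (Fin 2) ℂ)ˣ) : Matrix (Fin 2) (Fin 2) ℂ)) →
            ∃ c₀ : Matrix (Fin 2) (Fin 2) ℂ, (∀ y, c y = c₀) ∧ Commute c₀ σ₃) →
        ∀ U₀ ∈ {U' : GaugeField (F.P K) 0 (Matrix.specialUnitaryGroup (Fin 2) ℂ) | U' ∈ fibre F ℰp J K hJK V ∧ U' ∈ histGood F ℰp (θBal F.L γ b₀ p₀) K J ∧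
            wilsonAction4 U' = minActionRegPr F J K hJK ε₀ V},
        ∀ U ∈ fibre F ℰp J K hJK V, U ∈ histGood F ℰp (θBal F.L γ b₀ p₀) K J →
          μ * ((F.L : ℝ)⁻¹) ^ (2 * (K - J)) *
              (⨅ w : {w : GaugeTransf (F.P K) 0 (Matrix.specialUnitaryGroup (Fin 2) ℂ) | ∀ U : GaugeField (F.P K) 0 (Matrix.specialUnitaryGroup (Fin 2) ℂ),
                  descendTo F ℰp J K hJK (GaugeField.gaugeAct w U) = descendTo F ℰp J K hJK U}, ∑ ℓ : PBond (F.P K) 0,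
                dist1 (U ℓ * ((GaugeField.gaugeAct (w : GaugeTransf (F.P K) 0 (Matrix.specialUnitaryGroup (Fin 2) ℂ)) U₀) ℓ)⁻¹) ^ 2)
            ≤ wilsonAction4 U - minActionRegPr F J K hJK ε₀ V) :
    ∀ (L : ℕ), ∃ c₀ : ℝ, 0 < c₀ ∧ c₀ ≤ 1 ∧ ∀ (cw : ℝ), 0 < cw → cw ≤ c₀ → ∃ pS : ℝ, ∀ (b₀ p₀ : ℝ), 0 < b₀ → pS ≤ p₀ → 0 < p₀ → ∃ ε₁ : ℝ, 0 < ε₁ ∧ ∀ (ε₀ : ℝ), 0 < ε₀ → ε₀ ≤ ε₁ →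
    ∃ γ₁ : ℝ, 0 < γ₁ ∧ ∃ μ : ℝ, 0 < μ ∧ ∀ (F : T3Family) (γ : ℝ), F.L = L → 0 < γ → γ ≤ γ₁ → ∃ J₀ : ℕ,
      ∀ (J K : ℕ) (hJ₀ : J₀ ≤ J) (hJK : J ≤ K) (V : GaugeField (F.P J) 0 (Matrix.specialUnitaryGroup (Fin 2) ℂ)), PlaqSmall (θBal F.L γ (cw * b₀) p₀ J) V →
        ∀ U₀ ∈ {U' : GaugeField (F.P K) 0 (Matrix.specialUnitaryGroup (Fin 2) ℂ) | U' ∈ fibre F ℰp J K hJK V ∧ U' ∈ histGood F ℰp (θBal F.L γ b₀ p₀) K J ∧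
            wilsonAction4 U' = minActionRegPr F J K hJK ε₀ V},
        ∀ U ∈ fibre F ℰp J K hJK V, U ∈ histGood F ℰp (θBal F.L γ b₀ p₀) K J →
          μ * ((F.L : ℝ)⁻¹) ^ (2 * (K - J)) *
              (⨅ w : {w : GaugeTransf (F.P K) 0 (Matrix.specialUnitaryGroup (Fin 2) ℂ) | ∀ U : GaugeField (F.P K) 0 (Matrix.specialUnitaryGroup (Fin 2) ℂ),
                  descendTo F ℰp J K hJK (GaugeField.gaugeAct w U) = descendTo F ℰp J K hJK U}, ∑ ℓ : PBond (F.P K) 0,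
                dist1 (U ℓ * ((GaugeField.gaugeAct (w : GaugeTransf (F.P K) 0 (Matrix.specialUnitaryGroup (Fin 2) ℂ)) U₀) ℓ)⁻¹) ^ 2)
            ≤ wilsonAction4 U - minActionRegPr F J K hJK ε₀ V := by
  intro L
  obtain ⟨c₁, hc₁, hc₁1, H1⟩ := hIrr L
  obtain ⟨c₂, hc₂, -, H2⟩ := hA L
  obtain ⟨pS₃, H3⟩ := hFlat_holds L
  refine ⟨min c₁ c₂, lt_min hc₁ hc₂, (min_le_left _ _).trans hc₁1, ?_⟩
  intro cw hcw hcwle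
  obtain ⟨pS₁, H1⟩ := H1 cw hcw (hcwle.trans (min_le_left _ _))
  obtain ⟨pS₂, H2⟩ := H2 cw hcw (hcwle.trans (min_le_right _ _))
  refine ⟨max pS₁ (max pS₂ pS₃), ?_⟩
  intro b₀ p₀ hb hpS hp
  obtain ⟨e₁, he₁, H1⟩ := H1 b₀ p₀ hb ((le_max_left _ _).trans hpS) hp
  obtain ⟨e₂, he₂, H2⟩ := H2 b₀ p₀ hb (((le_max_left _ _).trans (le_max_right _ _)).trans hpS) hp
  obtain ⟨e₃, he₃, H3⟩ := H3 b₀ p₀ hb (((le_max_right _ _).trans (le_max_right _ _)).trans hpS) hp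
  refine ⟨min e₁ (min e₂ e₃), lt_min he₁ (lt_min he₂ he₃), ?_⟩
  intro ε₀ hε₀ hε₀le
  obtain ⟨γa, hγa, μa, hμa, H1⟩ := H1 ε₀ hε₀ (hε₀le.trans (min_le_left _ _))
  obtain ⟨γb, hγb, μb, hμb, H2⟩ := H2 ε₀ hε₀ (hε₀le.trans ((min_le_right _ _).trans (min_le_left _ _)))
  obtain ⟨γf, hγf, μf, hμf, H3⟩ := H3 ε₀ hε₀ (hε₀le.trans ((min_le_right _ _).trans (min_le_right _ _)))
  obtain ⟨γc, hγc, hγc1, hθ⟩ := exists_gamma_forall_θBal_le (b₀ := cw * b₀) (p₀ := p₀) (mul_pos hcw hb) hp (σ := 2) two_pos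
  refine ⟨min γa (min γb (min γf γc)), lt_min hγa (lt_min hγb (lt_min hγf hγc)), min μa (min μb μf), lt_min hμa (lt_min hμb hμf), ?_⟩
  intro F γ hFL hγ hγle
  -- the two strata floors at this `(F, γ)`; the flat stratum (✓`hFlat_holds`) has none
  obtain ⟨J₁, H1⟩ := H1 F γ hFL hγ (hγle.trans (min_le_left _ _))
  obtain ⟨J₂, H2⟩ := H2 F γ hFL hγ (hγle.trans ((min_le_right _ _).trans (min_le_left _ _)))
  refine ⟨max J₁ J₂, ?_⟩
  intro J K hJ₀ hJK V hV U₀ hU₀ U hU hUg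
  have hp0 : (0 : ℝ) ≤ ((F.L : ℝ)⁻¹) ^ (2 * (K - J)) := pow_nonneg (inv_nonneg.mpr (Nat.cast_nonneg _)) _
  have hI0 : (0 : ℝ) ≤ (⨅ w : {w : GaugeTransf (F.P K) 0 (Matrix.specialUnitaryGroup (Fin 2) ℂ) | ∀ U : GaugeField (F.P K) 0 (Matrix.specialUnitaryGroup (Fin 2) ℂ),
                  descendTo F ℰp J K hJK (GaugeField.gaugeAct w U) = descendTo F ℰp J K hJK U}, ∑ ℓ : PBond (F.P K) 0,
                dist1 (U ℓ * ((GaugeField.gaugeAct (w : GaugeTransf (F.P K) 0 (Matrix.specialUnitaryGroup (Fin 2) ℂ)) U₀) ℓ)⁻¹) ^ 2) :=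
    Real.iInf_nonneg fun w => Finset.sum_nonneg fun _ _ => sq_nonneg _
  rcases irr_or_caseA_or_loopHol_central V with hirr | hcA | ⟨x₀, hcen⟩
  · exact gapBody_mono_mu (min_le_left _ _) hp0 hI0
      (H1 J K ((le_max_left _ _).trans hJ₀) hJK V hV hirr U₀ hU₀ U hU hUg)
  · exact gapBody_mono_mu ((min_le_right _ _).trans (min_le_left _ _)) hp0 hI0
      (H2 J K ((le_max_right _ _).trans hJ₀) hJK V hV hcA U₀ hU₀ U hU hUg)
  · rcases Nat.eq_or_lt_of_le hJK with hJKeq | hlt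
    · subst hJKeq
      exact gapAt_depthZero F J hJK _ V U₀ hU₀.1 hU₀.2.2 U hU hUg
    · have hγc' : γ ≤ γc := hγle.trans ((min_le_right _ _).trans ((min_le_right _ _).trans (min_le_right _ _)))
      have hL : 1 ≤ F.L := F.hL.2.le
      have h2 : θBal F.L γ (cw * b₀) p₀ J ≤ 2 := hθ F.L hL γ hγ hγc' J
      exact gapBody_mono_mu ((min_le_right _ _).trans (min_le_right _ _)) hp0 hI0
        (gapFlatAt_caseB_of_flat_atArgmin F hlt hε₀ μf
          (H3 F γ hFL hγ (hγle.trans ((min_le_right _ _).trans ((min_le_right _ _).trans (min_le_left _ _)))) J K hlt)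
          V x₀ hcen h2 hV U₀ hU₀.1 hU₀.2.2 U hU hUg)

end Summit.QuantumFields.YangMills.Theorems.FluctuationComparisonRegPrIntLS2BetaGapOrbitOfStrataFloor

end
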